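import Literature.NumberTheory.DiophantineApproximation.PolylogTwoPointLinearIndependence
import Literature.NumberTheory.DiophantineApproximation.PolylogTwoPointParity
import Mathlib.Analysis.Complex.ExponentialBounds
import HarnessLib

/-!
# Linear independence of `1, Li_s(1/N), Li_s(−1/N)` (`s ≤ w`) over `ℚ` for `log N ≥ 4 (w+1)³`

Topic `Literature/NumberTheory/DiophantineApproximation`. The TWO-POINT case `K = ℚ`, `x = 0`,
`m = 2`, `α = (1, −1)`, `β = N` of David–Hirata-Kohno–Kawashima 2020, Thm 2.1, PROVED with a crude
threshold: for every weight `w ≥ 1` and every integer `N` with `log N ≥ 4 (w+1)³` the `2w + 1` numbers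
`1, Li_s(1/N), Li_s(−1/N)` (`1 ≤ s ≤ w`, `Li_s = DilogPade.polylogSeries s`) are linearly independent
over `ℚ` (`one_polylog_twoPoints_linearIndependent`); in particular (`w = 2`, `N ≥ 10⁴⁷`)
`1, Li₁(1/N), Li₂(1/N), Li₁(−1/N), Li₂(−1/N)` are (`dilogTwoPoints_linearIndependent` — the statement
of the tree's named fact `DHK2020_dilogTwoPointsLinearIndependent` with its threshold `10⁸` replaced by
`10⁴⁷`). Proof: the parity bridge `Li_s(±1/N) = 2^{−s} Li_s(1/N²) ± N Θ_s(1/N²)`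
(`PolylogTwoPointParity.lean`) turns a relation among `1, Li_s(±1/N)` into one among
`1, Li_s(1/N²), Θ_s(1/N²)` with coefficients `(b_s + c_s)/2^s`, `(b_s − c_s) N`, and those numbers are
independent for `log N² ≥ 8(w+1)³` (`one_polylog_oddPolylog_linearIndependent`,
`PolylogTwoPointLinearIndependence.lean`).
-- TODO(general form): the threshold `V > 0` of [DavidHirataKohnoKawashima2020, Thm 2.1] gives `N ≥ 10⁸`
-- for `w = 2`; general algebraic points `α`.

References: S. David, N. Hirata-Kohno, M. Kawashima, *Can polylogarithms at algebraic points be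
linearly independent?*, Moscow J. Comb. Number Th. 9 (2020) 389–406, Thm 2.1.
-/

noncomputable section

open Finset

namespace Literature.NumberTheory.DiophantineApproximation

open ParityPade

/-- **Linear independence of `1, Li_s(1/N), Li_s(−1/N)` (`1 ≤ s ≤ w`) over `ℚ`** for `w ≥ 1` and
`log N ≥ 4(w+1)³`: every rational relation
`a + ∑_{j<w} b_j Li_{j+1}(1/N) + ∑_{j<w} c_j Li_{j+1}(−1/N) = 0` is trivial
(David–Hirata-Kohno–Kawashima 2020, Thm 2.1 at the two points `±1/N`, crude threshold).
[cite: DavidHirataKohnoKawashima2020, Thm 2.1] -/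
theorem one_polylog_twoPoints_linearIndependent (w : ℕ) (hw : 1 ≤ w) (N : ℕ)
    (hN : 4 * ((w : ℝ) + 1) ^ 3 ≤ Real.log N) (a : ℚ) (b c : Fin w → ℚ)
    (h : (a : ℝ) + ∑ j : Fin w, (b j : ℝ) * DilogPade.polylogSeries ((j : ℕ) + 1) (1 / (N : ℝ)) +
      ∑ j : Fin w, (c j : ℝ) * DilogPade.polylogSeries ((j : ℕ) + 1) (-(1 / (N : ℝ))) = 0) :
    a = 0 ∧ b = 0 ∧ c = 0 := by
  -- `N ≥ 2`
  have hw1 : (1 : ℝ) ≤ w := by exact_mod_cast hw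
  have hL : (32 : ℝ) ≤ Real.log N := by
    calc (32 : ℝ) = 4 * 2 ^ 3 := by norm_num
      _ ≤ 4 * ((w : ℝ) + 1) ^ 3 := by gcongr; linarith
      _ ≤ Real.log N := hN
  have hN0 : (N : ℝ) ≠ 0 := by
    intro h0; rw [h0, Real.log_zero] at hL; linarith
  have hNpos : (0 : ℝ) < N := lt_of_le_of_ne (Nat.cast_nonneg N) (Ne.symm hN0)
  have hN2R : (2 : ℝ) ≤ N := by
    have h1 : Real.log N ≤ (N : ℝ) - 1 := Real.log_le_sub_one_of_pos hNpos
    linarith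
  have hN2 : 2 ≤ N := by exact_mod_cast hN2R
  -- `M = N²`, `log M = 2 log N ≥ 8(w+1)³`
  have hM : 8 * ((w : ℝ) + 1) ^ 3 ≤ Real.log ((N ^ 2 : ℕ) : ℝ) := by
    push_cast
    rw [Real.log_pow]
    push_cast
    linarith
  have hcast : (1 / ((N : ℝ) ^ 2)) = 1 / ((N ^ 2 : ℕ) : ℝ) := by push_cast; ring
  -- rewrite the relation through the parity bridge
  have h' : (a : ℝ) +
      ∑ j : Fin w, (((b j + c j) / 2 ^ ((j : ℕ) + 1) : ℚ) : ℝ) *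
        DilogPade.polylogSeries ((j : ℕ) + 1) (1 / ((N ^ 2 : ℕ) : ℝ)) +
      ∑ j : Fin w, (((b j - c j) * N : ℚ) : ℝ) *
        oddPolylogSeries ((j : ℕ) + 1) (1 / ((N ^ 2 : ℕ) : ℝ)) = 0 := by
    rw [← h, ← hcast]
    have e : ∀ j : Fin w,
        (b j : ℝ) * DilogPade.polylogSeries ((j : ℕ) + 1) (1 / (N : ℝ)) +
          (c j : ℝ) * DilogPade.polylogSeries ((j : ℕ) + 1) (-(1 / (N : ℝ))) =
        (((b j + c j) / 2 ^ ((j : ℕ) + 1) : ℚ) : ℝ) *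
            DilogPade.polylogSeries ((j : ℕ) + 1) (1 / ((N : ℝ) ^ 2)) +
          (((b j - c j) * N : ℚ) : ℝ) * oddPolylogSeries ((j : ℕ) + 1) (1 / ((N : ℝ) ^ 2)) := by
      intro j
      rw [polylogSeries_one_div_eq _ hN2, polylogSeries_neg_one_div_eq _ hN2]
      push_cast
      ring
    rw [add_assoc, add_assoc, ← Finset.sum_add_distrib, ← Finset.sum_add_distrib]
    congr 1
    exact Finset.sum_congr rfl fun j _ => (e j).symm
  obtain ⟨ha, hb, hc⟩ := one_polylog_oddPolylog_linearIndependent w hw (N ^ 2) hM a _ _ h'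
  have hNQ : (N : ℚ) ≠ 0 := by exact_mod_cast (show N ≠ 0 by omega)
  have hbc : ∀ j, b j + c j = 0 ∧ b j - c j = 0 := by
    intro j
    have h1 := congrFun hb j
    have h2 := congrFun hc j
    simp only [Pi.zero_apply, div_eq_zero_iff, pow_eq_zero_iff', OfNat.ofNat_ne_zero, ne_eq,
      false_and, or_false, mul_eq_zero, hNQ] at h1 h2
    exact ⟨h1, h2⟩
  refine ⟨ha, ?_, ?_⟩
  · funext j
    have := hbc j
    simp only [Pi.zero_apply]
    linarith [this.1, this.2]
  · funext j
    have := hbc j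
    simp only [Pi.zero_apply]
    linarith [this.1, this.2]

/-- `log N ≥ 108` for `N ≥ 10⁴⁷` (`e^{108} < 2.7182818286^{108} < 10⁴⁷`). [folklore] -/
theorem log_ge_of_ten_pow_47_le {N : ℕ} (hN : 10 ^ 47 ≤ N) : (108 : ℝ) ≤ Real.log N := by
  have hNR : ((10 : ℝ) ^ 47) ≤ N := by exact_mod_cast hN
  have hNpos : (0 : ℝ) < N := lt_of_lt_of_le (by positivity) hNR
  rw [Real.le_log_iff_exp_le hNpos]
  refine le_trans ?_ hNR
  have h1 : Real.exp 108 = Real.exp 1 ^ 108 := by rw [← Real.exp_nat_mul]; norm_num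
  rw [h1]
  calc Real.exp 1 ^ 108 ≤ (2.7182818286 : ℝ) ^ 108 :=
        pow_le_pow_left₀ (Real.exp_pos 1).le Real.exp_one_lt_d9.le 108
    _ ≤ (10 : ℝ) ^ 47 := by norm_num

/-- **`1, Li₁(1/N), Li₂(1/N), Li₁(−1/N), Li₂(−1/N)` are linearly independent over `ℚ` for every
integer `N ≥ 10⁴⁷`** — the statement of the tree's named fact `DHK2020_dilogTwoPointsLinearIndependent`
(David–Hirata-Kohno–Kawashima 2020, Thm 2.1 with `K = ℚ`, `x = 0`, `r = m = 2`, `α = (1,−1)`,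
`β = N`), PROVED here with the crude threshold `10⁴⁷` in place of the paper's `10⁸`
(`one_polylog_twoPoints_linearIndependent` with `w = 2`: `log N ≥ 108`).
[cite: DavidHirataKohnoKawashima2020, Thm 2.1] -/
theorem dilogTwoPoints_linearIndependent (N : ℕ) (hN : 10 ^ 47 ≤ N) (a b₁ c₁ b₂ c₂ : ℚ)
    (hrel : (a : ℝ) + b₁ * DilogPade.polylogSeries 1 (1 / (N : ℝ)) +
        c₁ * DilogPade.polylogSeries 2 (1 / (N : ℝ)) +
        b₂ * DilogPade.polylogSeries 1 (-(1 / (N : ℝ))) +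
        c₂ * DilogPade.polylogSeries 2 (-(1 / (N : ℝ))) = 0) :
    a = 0 ∧ b₁ = 0 ∧ c₁ = 0 ∧ b₂ = 0 ∧ c₂ = 0 := by
  have hlog : 4 * (((2 : ℕ) : ℝ) + 1) ^ 3 ≤ Real.log N := by
    have := log_ge_of_ten_pow_47_le hN
    norm_num
    linarith
  have h := one_polylog_twoPoints_linearIndependent 2 (by norm_num) N hlog a ![b₁, c₁] ![b₂, c₂] (by
    simp only [Fin.sum_univ_two, Matrix.cons_val_zero, Matrix.cons_val_one, Fin.val_zero,
      Fin.val_one]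
    push_cast
    linear_combination hrel)
  obtain ⟨ha, hb, hc⟩ := h
  have hb0 := congrFun hb 0
  have hb1 := congrFun hb 1
  have hc0 := congrFun hc 0
  have hc1 := congrFun hc 1
  simp only [Matrix.cons_val_zero, Matrix.cons_val_one, Pi.zero_apply] at hb0 hb1 hc0 hc1
  exact ⟨ha, hb0, hb1, hc0, hc1⟩

end Literature.NumberTheory.DiophantineApproximation
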